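import Summits.ResolutionOfSingularities.ResolutionOfSingularities.Theorems.HilbertSamuelEliminationSigmaMaxModificationsCorridor3WLadderHybridLowBirths
import Summits.ResolutionOfSingularities.ResolutionOfSingularities.Theorems.HilbertSamuelEliminationSigmaMaxModificationsCorridor3WLadderMovingTwoCensus2
import HarnessLib

/-!
# [OURS · L1 W4.2] `Corridor3WLadderHybridLowBirthsGeomDir` — THE (b) SUPPLIER AT W-LOW FOR EVERY PRIME: res-type-040's
# `…HybridLowBirths` ((c-swallow) ⇒ (b) «components through `x_{n+1}` dominate components through `x_n»`, regime `3 ≤ p` through `CharHypothesis`)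
# re-keyed to the (F1♯) binders `Theorem314_geomDir` / `Theorem314_nearFibre_geomDir` — automatic at `ē ≤ 2`, hence NO characteristic hypothesis —
# and discharged modulo F-51′ `Hironaka1970_thmIV` alone (crux `SigmaMaxModifications` stmt-ResolutionOfSingularities-18506 / conjunct stmt-…-19249,
# line `w_ladder`, E7-Low row (b)From; `--supports 19249`, helper)

Seat res-D-pv-038 (gen 9). Sorry-free PROOF file, no definition, no named fact beyond the (F1♯) doors taken BY NAME and F-51′ in §3. OURS bookkeeping for
the W4.2 crux chain (cell res-hironaka); NOT a statement of [Hironaka2017] nor of [CossartJannsenSaito2020]. AI-written; AI review is weaker than expert review.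

res-type-040's `strataBirthsSettleFromσE_init_of_swallow` (`…HybridLowBirths`) removes (b)From from E7's Low residual list in the (F1) regime `3 ≤ p` only,
because it feeds the printed CJS Thm. 3.14 (numerical `CossartJannsenSaito2020_thm_3_14`, near-fibre `Thm314_nearFibre_subsingleton`) with `CharHypothesis`
along the run (`charHypothesis_of_reachesσE`, `3 ≤ p`). At W-low points (`ē ≤ 2`) the (F1♯) hypothesis `GeomDirHypothesis` holds in EVERY characteristic
(stub-3's `geomDirHypothesis_of_geomDirDim_le_two`), and the (F1♯) binders `Theorem314_geomDir` / `Theorem314_nearFibre_geomDir` are tree theorems modulo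
F-51′ (res-type-001 / stub-3 g4). So the same proof gives (b)From for every prime:

* §1 `StepProjectionσE.closure_image_mem_componentsIn_of_swallow_geomDir` — 040's one-step law, (F1) ↦ (F1♯), `hchar` dropped;
* §2 `strataBirthsSettleFromσE_of_swallow_geomDir` — (c-swallow)From ⇒ (b)From on the From-`s₀` scope, grade `G ⊆ (ē ≤ 2)`, no characteristic clause;
* §3 `strataBirthsSettleFromσE_init_of_swallow_geomDir` (σ admissible on its run-wise scope, any `p`), **`…_of_thmIV (h51 : Hironaka1970_thmIV)`**, and the
  hybrid Low class `low_init_hybrid_of_rows_of_swallow_geomDir` / `_of_thmIV` for EVERY prime from (c-rep), (c-menu) and the units half.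

[OURS · L1 W4.2; AI-written] [cite: CossartJannsenSaito2020, Thm. 3.14, Def. 3.1, Rem. 6.29 (1)] [cite: Hironaka1970NumericalCharacters, THEOREM IV p. 156]
-/

noncomputable section

set_option linter.dupNamespace false

open CategoryTheory CategoryTheory.Limits AlgebraicGeometry TopologicalSpace Topology IsLocalRing
open Summit.ResolutionOfSingularities.ResolutionOfSingularities.Theorems.CampaignW42
open Literature.AlgebraicGeometry.Resolution Literature.RingTheory.HilbertSamuel
open Literature.AlgebraicGeometry.CossartJannsenSaito2020
open Summit.ResolutionOfSingularities.ResolutionOfSingularities.Theorems.SigmaMaxModificationsCorridor3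
open Summit.ResolutionOfSingularities.ResolutionOfSingularities.Theorems.SigmaMaxModificationsCorridor3.Moving

namespace Summit.ResolutionOfSingularities.ResolutionOfSingularities.Theorems.SigmaMaxModificationsCorridor3.Sigma

universe u

variable {N : ℕ} {ν : ℕ → ℕ} {k : Type u} [Field k] {σ : StrategyE.{u}}

/-! ## §1. The one-step law, (F1♯) form -/

variable {N : ℕ} {ν : ℕ → ℕ} {k : Type u} [Field k] {σ : StrategyE.{u}}

/-! ## §1. The one-step law -/

/-- **ONE STEP: at a W-low never-isolated chain point whose blow-up swallows a stratum component, every stratum component through the next chain point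
DOMINATES a stratum component** — res-type-040's `StepProjectionσE.closure_image_mem_componentsIn_of_swallow` (p-port of stub-4's (b-fib)/(b-curve)) with the
printed CJS Thm. 3.14 renderings under `CharHypothesis` REPLACED by the (F1♯) binders `Theorem314_geomDir` / `Theorem314_nearFibre_geomDir` under
`GeomDirHypothesis`, which is automatic at `ē ≤ 2` (`geomDirHypothesis_of_geomDirDim_le_two`): NO characteristic hypothesis. Proof otherwise verbatim.
[cite: CossartJannsenSaito2020, Thm. 3.14, Def. 3.1] -/
theorem StepProjectionσE.closure_image_mem_componentsIn_of_swallow_geomDir (hF : Theorem314_geomDir.{u})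
    (hFf : Theorem314_nearFibre_geomDir.{u}) {s s' : MarkedStageE.{u}} {f : s'.W ⟶ s.W} (hf : StepProjectionσE σ N ν s s' f)
    (hgood : RunGood k N ν s.W) (hgood' : RunGood k N ν s'.W)
    (hadm : ∀ (C : s.W.IdealSheafData) (P' : Option (Pending (blowup C))), σ.step s.W s.ln N ν s.L s.P s.E C P' →
      IdealSheafData.IsPermissible C ∧ (C.support : Set s.W) ⊆ Scheme.hsStratum s.W N ν)
    (hpt : s.pt ∈ Scheme.hsStratum s.W N ν) (hptcl : IsClosed ({s.pt} : Set s.W)) (hnot : ¬ Iso N s.toMarkedStage)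
    (hnot' : ¬ Iso N s'.toMarkedStage) (hlow : s.toMarkedStage.geomDirDim ≤ 2)
    (hsw : ∀ (C : s.W.IdealSheafData) (P' : Option (Pending (blowup C))), σ.step s.W s.ln N ν s.L s.P s.E C P' →
      s.pt ∈ (C.support : Set s.W) → ∃ Z ∈ componentsThrough N ν s.toMarkedStage, Z ⊆ (C.support : Set s.W))
    {Z' : Set s'.W} (hZ' : Z' ∈ componentsThrough N ν s'.toMarkedStage) :
    closure (f.base '' Z') ∈ componentsIn (Scheme.hsStratum s.W N ν) := by
  by_contra hbirth
  have hx'ν : s'.pt ∈ Scheme.hsStratum s'.W N ν := hf.pt_mem_hsStratum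
  obtain ⟨C, P', hln, x', hcs, hπ, -, hx', e, rfl⟩ := hf
  subst e
  simp only [eqToHom_refl, Category.id_comp] at hbirth ⊢
  haveI : IsLocallyNoetherian s.W := s.ln
  haveI : IsLocallyNoetherian (blowup C) := hln
  -- (F1♯) at the chain point: automatic at `ē ≤ 2`
  have hgdh : GeomDirHypothesis s.W s.pt := geomDirHypothesis_of_geomDirDim_le_two hlow
  haveI : IsNoetherian s.W := by
    obtain ⟨g, hg, hq⟩ := hgood.overField
    exact Scheme.isNoetherian_of_finiteType_over_field g
  haveI : IsNoetherian (blowup C) := by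
    obtain ⟨g, hg, hq⟩ := hgood'.overField
    exact Scheme.isNoetherian_of_finiteType_over_field g
  obtain ⟨hperm, hCsub⟩ := hadm C P' hcs
  have hCreg : Literature.AlgebraicGeometry.Resolution.Scheme.IsRegular C.subscheme := isRegular_subscheme_of_isPermissible hperm
  have hexc : Scheme.IsExcellent s.W := hgood.isExcellent
  have hY : IsClosed (Scheme.hsStratum s.W N ν) := hgood.isClosed_hsStratum
  have hY' : IsClosed (Scheme.hsStratum (blowup C) N ν) := hgood'.isClosed_hsStratum
  have hπY' : (blowup.π C).base '' Scheme.hsStratum (blowup C) N ν ⊆ Scheme.hsStratum s.W N ν := by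
    rintro _ ⟨z, hz, rfl⟩
    have hle := (blowup.isBlowup C).hsFun_le_of_isPermissible hexc hperm N z
    exact hgood.supMax _ ((Scheme.mem_hsStratum_iff.mp hz).symm.le.trans hle)
  have hST : ∀ T, T ⊆ Scheme.hsStratum s.W N ν →
      strictTransformSet (blowup.π C) (C.support : Set s.W) T ⊆ Scheme.hsStratum (blowup C) N ν :=
    fun T hT => strictTransformSet_subset_hsStratum C hT hY'
  -- births lie over the centre, so the chain point lies in the centre
  have hZ'sub : Z' ⊆ (blowup.π C).base ⁻¹' (C.support : Set s.W) :=
    subset_preimage_support_of_not_mem_componentsIn C hY (componentsIn.finite _) hY' (componentsIn.finite _) hπY' hST hZ'.1 hbirth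
  have hmem : s.pt ∈ (C.support : Set s.W) := by
    have h := hZ'sub hZ'.2
    rw [Set.mem_preimage] at h
    change (blowup.π C).base x' ∈ _ at h
    rwa [hπ] at h
  -- the swallowed component and a generisation of the chain point inside the centre
  obtain ⟨Z, hZT, hZC⟩ := hsw C P' hcs hmem
  have hZnt : Z.Nontrivial := nontrivial_of_mem_componentsThrough_of_not_iso hgood hpt hnot hZT
  have hZirr : IsIrreducible Z := componentsIn.isIrreducible hZT.1
  have hZcl : IsClosed Z := componentsIn.isClosed hY hZT.1
  have hZgen : IsGenericPoint hZirr.genericPoint Z := hZirr.isGenericPoint_genericPoint hZcl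
  have hηx : hZirr.genericPoint ⤳ s.pt := hZgen.specializes hZT.2
  have hηne : hZirr.genericPoint ≠ s.pt := by
    intro h
    obtain ⟨a, ha, b, hb, hab⟩ := hZnt
    have hZs : Z = {s.pt} := by rw [← hZgen.def, h, hptcl.closure_eq]
    rw [hZs] at ha hb
    exact hab (ha.trans hb.symm)
  have h1 : (1 : WithBot ℕ∞) ≤ ringKrullDim (s.W.presheaf.stalk s.pt ⧸ stalkIdeal C s.pt) :=
    one_le_ringKrullDim_quotient_stalkIdeal C hηx hηne (hZC hZgen.mem)
  -- `e ≤ ē ≤ 2`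
  have he2 : (Scheme.dirDim s.W s.pt : WithBot ℕ∞) ≤ 2 := by
    have h : Scheme.dirDim s.W s.pt ≤ 2 := (Scheme.dirDim_le_geomDirDim s.pt).trans hlow
    exact_mod_cast h
  -- F-61: the near fibre over the chain point is a subsingleton
  have hfib : {z : ↥(blowup C) | (blowup.π C).base z = s.pt ∧
      Scheme.hsFun (blowup C) N z = Scheme.hsFun s.W N s.pt}.Subsingleton := by
    refine hFf s.W (blowup C) (blowup.π C) C hexc hperm (blowup.isBlowup C) N hgood.dim_le s.pt hmem hgdh ?_
    refine he2.trans ?_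
    have h2 : (2 : WithBot ℕ∞) = 1 + 1 := by norm_num
    rw [h2]
    exact add_le_add h1 le_rfl
  -- Thm. 3.14 (numerical) at the near point `x'`: `dim 𝒪_{V(C),x} < e_x ≤ 2`
  have hlt : ringKrullDim (s.W.presheaf.stalk s.pt ⧸ stalkIdeal C s.pt) < 2 := by
    have key := hF s.W (blowup C) (blowup.π C) C N x' s.pt hexc hperm (blowup.isBlowup C) hgood.dim_le hπ hmem hgdh
      (by rw [Scheme.mem_hsStratum_iff.mp hx', Scheme.mem_hsStratum_iff.mp hpt])
    exact key.trans_le he2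
  -- the generic point of `Z'` and its image
  have hZ'irr : IsIrreducible Z' := componentsIn.isIrreducible hZ'.1
  have hZ'cl : IsClosed Z' := componentsIn.isClosed hY' hZ'.1
  have hζ : IsGenericPoint hZ'irr.genericPoint Z' := hZ'irr.isGenericPoint_genericPoint hZ'cl
  set ζ := hZ'irr.genericPoint with hζdef
  have hclA : closure ((blowup.π C).base '' Z') = closure {(blowup.π C).base ζ} := by
    conv_lhs => rw [← hζ.def]
    exact closure_image_closure_singleton (blowup.π C).continuous ζ
  by_cases ha : (blowup.π C).base ζ = s.pt
  · -- `Z'` lies in the near fibre over `x`: `Z' = {x'}`, impossible at a never-isolated stage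
    have hZ'fib : Z' ⊆ {z : ↥(blowup C) | (blowup.π C).base z = s.pt ∧
        Scheme.hsFun (blowup C) N z = Scheme.hsFun s.W N s.pt} := by
      intro z hz
      refine ⟨?_, ?_⟩
      · have hz1 : (blowup.π C).base z ∈ closure {(blowup.π C).base ζ} := by
          rw [← hclA]
          exact subset_closure ⟨z, hz, rfl⟩
        rw [ha, hptcl.closure_eq] at hz1
        exact hz1
      · rw [Scheme.mem_hsStratum_iff.mp (componentsIn.subset hZ'.1 hz), Scheme.mem_hsStratum_iff.mp hpt]
    have hx'fib : x' ∈ {z : ↥(blowup C) | (blowup.π C).base z = s.pt ∧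
        Scheme.hsFun (blowup C) N z = Scheme.hsFun s.W N s.pt} :=
      ⟨hπ, by rw [Scheme.mem_hsStratum_iff.mp hx', Scheme.mem_hsStratum_iff.mp hpt]⟩
    have hsub : Z' ⊆ {x'} := fun z hz => hfib (hZ'fib hz) hx'fib
    have hZ'nt : Z'.Nontrivial := nontrivial_of_mem_componentsThrough_of_not_iso hgood' hx'ν hnot' hZ'
    obtain ⟨a, ha', b, hb', hab⟩ := hZ'nt
    exact hab ((hsub ha').trans (hsub hb').symm)
  · -- `A = closure {π ζ}` is an irreducible closed subset of `V(C)` through `x`, not `{x}`: a component of `V(C)`, hence `= Z`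
    have hAsub : closure {(blowup.π C).base ζ} ⊆ (C.support : Set s.W) :=
      closure_minimal (Set.singleton_subset_iff.mpr (hZ'sub hζ.mem)) C.support.isClosed
    have hAirr : IsIrreducible (closure {(blowup.π C).base ζ}) := isIrreducible_singleton.closure
    have hxA : s.pt ∈ closure {(blowup.π C).base ζ} := by
      rw [← hclA]
      exact subset_closure ⟨x', hZ'.2, hπ⟩
    -- `A` is a component of `V(C)`
    have hAcomp : closure {(blowup.π C).base ζ} ∈ componentsIn (C.support : Set s.W) := by
      by_contra hnotA
      obtain ⟨D₀, hD₀, hAD⟩ := exists_componentsIn_superset C.support.isClosed (componentsIn.finite _) hAirr hAsub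
      have hAD' : closure {(blowup.π C).base ζ} ≠ D₀ := fun h => hnotA (h ▸ hD₀)
      have hD₀irr : IsIrreducible D₀ := componentsIn.isIrreducible hD₀
      have hD₀cl : IsClosed D₀ := componentsIn.isClosed C.support.isClosed hD₀
      have hAgen : IsGenericPoint hAirr.genericPoint (closure {(blowup.π C).base ζ}) :=
        hAirr.isGenericPoint_genericPoint isClosed_closure
      have hDgen : IsGenericPoint hD₀irr.genericPoint D₀ := hD₀irr.isGenericPoint_genericPoint hD₀cl
      have hax : hAirr.genericPoint ⤳ s.pt := hAgen.specializes hxA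
      have hηa : hD₀irr.genericPoint ⤳ hAirr.genericPoint := hDgen.specializes (hAD hAgen.mem)
      have hne₁ : hAirr.genericPoint ≠ s.pt := by
        intro h
        apply ha
        have : (blowup.π C).base ζ ∈ ({s.pt} : Set s.W) := by
          rw [← hptcl.closure_eq, ← h, hAgen.def]
          exact subset_closure (Set.mem_singleton _)
        exact this
      have hne₂ : hD₀irr.genericPoint ≠ hAirr.genericPoint := by
        intro h
        apply hAD'
        rw [← hAgen.def, ← hDgen.def, h]
      have h2 := two_le_ringKrullDim_quotient_stalkIdeal C hax hηa hne₁ hne₂ ((componentsIn.subset hD₀) hDgen.mem)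
        (hAsub hAgen.mem)
      exact absurd (h2.trans_lt hlt) (lt_irrefl _)
    -- `Z` is a component of `V(C)` as well
    have hZcomp : Z ∈ componentsIn (C.support : Set s.W) := by
      obtain ⟨D₁, hD₁, hZD⟩ := exists_componentsIn_superset C.support.isClosed (componentsIn.finite _) hZirr hZC
      have hD₁Z : D₁ ⊆ Z := (mem_componentsIn_iff.mp hZT.1).2.2 D₁ ((componentsIn.subset hD₁).trans hCsub)
        (componentsIn.isIrreducible hD₁) hZD
      have : Z = D₁ := Set.Subset.antisymm hZD hD₁Z
      rw [this]
      exact hD₁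
    have hAZ : closure {(blowup.π C).base ζ} = Z := eq_of_mem_componentsIn_of_isRegular hCreg hAcomp hZcomp hxA hZT.2
    apply hbirth
    rw [hclA, hAZ]
    exact hZT.1

/-! ## §2. (c-swallow)From ⇒ (b)From at W-low, every characteristic -/

/-- **THE (b) SUPPLIER, (F1♯) form — PROVED for every characteristic**: on the From-`s₀` scope of the Low adapter, for a grade `G ⊆ (ē ≤ 2)`,
`StrataSwallowFromσE σ N ν s₀ G → StrataBirthsSettleFromσE σ N ν s₀ G` (any boundary-reading `σ` whose steps at reached states have permissible in-stratum
centres; good stages; closed marked point of `s₀` in the stratum), modulo the (F1♯) binders; NO `CharHypothesis`. [cite: CossartJannsenSaito2020, Thm. 3.14, Rem. 6.29 (1)] -/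
theorem strataBirthsSettleFromσE_of_swallow_geomDir (hF : Theorem314_geomDir.{u}) (hFf : Theorem314_nearFibre_geomDir.{u})
    {s₀ : MarkedStageE.{u}} {G : MarkedStage.{u} → Prop} (hG : ∀ s, G s → s.geomDirDim ≤ 2)
    (hgood : ∀ s, ReachesσE σ N ν s₀ s → RunGood k N ν s.W)
    (hadm : ∀ s, ReachesσE σ N ν s₀ s → ∀ (C : s.W.IdealSheafData) (P' : Option (Pending (blowup C))),
      σ.step s.W s.ln N ν s.L s.P s.E C P' → IdealSheafData.IsPermissible C ∧ (C.support : Set s.W) ⊆ Scheme.hsStratum s.W N ν)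
    (hpt₀ : s₀.pt ∈ Scheme.hsStratum s₀.W N ν) (hptcl₀ : IsClosed ({s₀.pt} : Set s₀.W))
    (hswallow : StrataSwallowFromσE σ N ν s₀ G) : StrataBirthsSettleFromσE σ N ν s₀ G := by
  intro c h0 hstep hGc hnI hmov
  obtain ⟨n₂, hn₂⟩ := hswallow c h0 hstep hGc hnI hmov
  have hreach : ∀ n, ReachesσE σ N ν s₀ (c n) := reachesσE_chain h0 hstep
  refine ⟨n₂, fun n hn f hf Z' hZ' => ?_⟩
  exact hf.closure_image_mem_componentsIn_of_swallow_geomDir hF hFf (hgood _ (hreach n)) (hgood _ (hreach (n + 1))) (hadm _ (hreach n))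
    (pt_mem_hsStratum_of_reachesσE (hreach n) hpt₀) ((hreach n).isClosed_pt hptcl₀) (hnI n) (hnI (n + 1)) (hG _ (hGc n))
    (fun C P' hcs hx => hn₂ n hn C P' hcs hx) hZ'

/-! ## §3. The origin-level forms, every prime; modulo F-51′ -/

/-- **THE (b) SUPPLIER AT A MAXIMAL ORIGIN, EVERY PRIME** (σ admissible on its run-wise scope; grade `ē < 3`): (c-swallow)From ⇒ (b)From at
`MarkedStageE.init X x (E₀ X x)`, modulo the (F1♯) binders. 040's `strataBirthsSettleFromσE_init_of_swallow` without `3 ≤ p`.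
[cite: CossartJannsenSaito2020, Thm. 3.14, Thm. 3.10 (1)] -/
theorem strataBirthsSettleFromσE_init_of_swallow_geomDir (hF : Theorem314_geomDir.{u}) (hFf : Theorem314_nearFibre_geomDir.{u})
    {p : ℕ} {E₀ : ∀ (X : Scheme.{u}), X → Boundary X}
    (hadm : IsAdmissibleStrategyOnE (StrategyE.RunReachableState p σ 3 ν E₀) 3 ν σ)
    {X : Scheme.{u}} [IsLocallyNoetherian X] {x : X} (hX : IsMaximalOrigin p 3 ν X x)
    (hswallow : StrataSwallowFromσE σ 3 ν (MarkedStageE.init X x (E₀ X x)) fun s => s.geomDirDim < 3) :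
    StrataBirthsSettleFromσE σ 3 ν (MarkedStageE.init X x (E₀ X x)) fun s => s.geomDirDim < 3 := by
  obtain ⟨k', hk', hchp, g, -, hft, hqc⟩ := hX.exists_structure
  have h0 : RunGood k' 3 ν X := ⟨⟨g, hft, hqc⟩, hX.isReduced, hX.dim_le, fun w hw => le_antisymm (hX.maximal.2 ⟨w, rfl⟩ hw) hw⟩
  have hperm : ∀ (W : Scheme.{u}) (hW : IsLocallyNoetherian W) (L : Labelling W) (P : Option (Pending W)) (E : Boundary W),
      StrategyE.RunReachableState p σ 3 ν E₀ W hW L P E →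
        ∀ (C : W.IdealSheafData) (P' : Option (Pending (blowup C))), σ.step W hW 3 ν L P E C P' → IdealSheafData.IsPermissible C :=
    fun W hW L P E hS C P' hst => ((hadm W hW L P E hS).1 C P' hst).1
  have hscope : ∀ s : MarkedStageE.{u}, ReachesσE σ 3 ν (MarkedStageE.init X x (E₀ X x)) s →
      StrategyE.RunReachableState p σ 3 ν E₀ s.W s.ln s.L s.P s.E := fun s hs =>
    StrategyE.reachableState_subset_runReachableState (StrategyE.reachableState_of_inScopeMσE ⟨X, inferInstance, x, hX, hs⟩)
  have hgood : ∀ s : MarkedStageE.{u}, ReachesσE σ 3 ν (MarkedStageE.init X x (E₀ X x)) s → RunGood k' 3 ν s.W := fun s hs =>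
    runGood_of_stateReachesσE (t := s.toStateσE) hX h0 hperm hs.stateReachesσE
  refine strataBirthsSettleFromσE_of_swallow_geomDir (k := k') hF hFf (fun s (hs : s.geomDirDim < 3) => by omega) hgood
    (fun s hs C P' hst => ?_) hX.mem_stratum hX.isClosed hswallow
  obtain ⟨h1, h2, -⟩ := (hadm s.W s.ln s.L s.P s.E (hscope s hs)).1 C P' hst
  exact ⟨h1, h2⟩

/-- **THE (b) SUPPLIER AT A MAXIMAL ORIGIN, EVERY PRIME, MODULO F-51′ `Hironaka1970_thmIV` ALONE** (the two (F1♯) binders from [H4] Th. IV and the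
Hironaka–Grothendieck isomorphism, res-type-001 / stub-3 g4). [cite: Hironaka1970NumericalCharacters, THEOREM IV p. 156] [cite: CossartJannsenSaito2020, Thm. 3.14] -/
theorem strataBirthsSettleFromσE_init_of_swallow_of_thmIV (h51 : Hironaka1970_thmIV.{u})
    {p : ℕ} {E₀ : ∀ (X : Scheme.{u}), X → Boundary X}
    (hadm : IsAdmissibleStrategyOnE (StrategyE.RunReachableState p σ 3 ν E₀) 3 ν σ)
    {X : Scheme.{u}} [IsLocallyNoetherian X] {x : X} (hX : IsMaximalOrigin p 3 ν X x)
    (hswallow : StrataSwallowFromσE σ 3 ν (MarkedStageE.init X x (E₀ X x)) fun s => s.geomDirDim < 3) :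
    StrataBirthsSettleFromσE σ 3 ν (MarkedStageE.init X x (E₀ X x)) fun s => s.geomDirDim < 3 :=
  strataBirthsSettleFromσE_init_of_swallow_geomDir
    (Directrix214Sharp.theorem314_geomDir_of_thmIV_of_split h51 HerrmannIkedaOrbanz1988_cor_21_11_holds)
    (Directrix214Sharp.theorem314_nearFibre_geomDir_of_facts h51 HerrmannIkedaOrbanz1988_cor_21_11_holds) hadm hX hswallow

/-- **E7's LOW CLASS AT A MAXIMAL ORIGIN FOR THE MENU HYBRID, EVERY PRIME, from (c-rep), (c-menu) and the units half ONLY** ((b) supplied by §3,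
(c-swallow) by `…HybridLowSwallow`), modulo the kill row and the two (F1♯) binders — 040's `low_init_hybrid_of_rows_of_swallow` without `3 ≤ p`.
[cite: CossartJannsenSaito2020, Thm. 3.14, Thm. 6.35, Thm. 6.40, p. 107] -/
theorem low_init_hybrid_of_rows_of_swallow_geomDir {π : StrategyE.{u}} {ω : StageOracleE.{u}} (hK : LocalNearPointChainsTerminate.{u})
    (hF : Theorem314_geomDir.{u}) (hFf : Theorem314_nearFibre_geomDir.{u}) {p : ℕ}
    (hπ : π.IsFunctional 3 ν) (hω : OracleFunctionalΩE ω) {E₀ : ∀ (X : Scheme.{u}), X → Boundary X}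
    (hadm : IsAdmissibleStrategyOnE (StrategyE.RunReachableState p (π.hybrid (StrategyE.ofStageOracleE ω)) 3 ν E₀) 3 ν
      (π.hybrid (StrategyE.ofStageOracleE ω)))
    {X : Scheme.{u}} [IsLocallyNoetherian X] {x : X} (hX : IsMaximalOrigin p 3 ν X x)
    (hrep : StrataReplaySettleFromσE (π.hybrid (StrategyE.ofStageOracleE ω)) 3 ν (MarkedStageE.init X x (E₀ X x))
      fun s => s.geomDirDim < 3)
    (hmenu : StrataPolicySwallowFromσE π (π.hybrid (StrategyE.ofStageOracleE ω)) 3 ν (MarkedStageE.init X x (E₀ X x))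
      fun s => s.geomDirDim < 3)
    (hunits : NoMovingRecurrentNearChainFromσE (π.hybrid (StrategyE.ofStageOracleE ω)) 3 ν (MarkedStageE.init X x (E₀ X x))
      (fun s => s.geomDirDim < 3) fun s => Iso 3 s) :
    ∀ e, e < 3 → NoMovingNearChainFromσE (π.hybrid (StrategyE.ofStageOracleE ω)) 3 ν (MarkedStageE.init X x (E₀ X x))
      fun s => s.geomDirDim = e := by
  have hsw := strataSwallowFromσE_hybrid_of_replaySettle_menuSwallow hπ hω hrep hmenu
  exact low_init_of_births_swallow_units hK (by norm_num) le_rfl (hπ.hybrid (StrategyE.isFunctional_ofStageOracleE hω 3 ν)) hadm hX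
    (strataBirthsSettleFromσE_init_of_swallow_geomDir hF hFf hadm hX hsw) hsw hunits

/-- **The same MODULO F-51′ alone.** [cite: Hironaka1970NumericalCharacters, THEOREM IV p. 156] [cite: CossartJannsenSaito2020, Thm. 6.35, Thm. 6.40, p. 107] -/
theorem low_init_hybrid_of_rows_of_swallow_of_thmIV {π : StrategyE.{u}} {ω : StageOracleE.{u}} (hK : LocalNearPointChainsTerminate.{u})
    (h51 : Hironaka1970_thmIV.{u}) {p : ℕ} (hπ : π.IsFunctional 3 ν) (hω : OracleFunctionalΩE ω) {E₀ : ∀ (X : Scheme.{u}), X → Boundary X}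
    (hadm : IsAdmissibleStrategyOnE (StrategyE.RunReachableState p (π.hybrid (StrategyE.ofStageOracleE ω)) 3 ν E₀) 3 ν
      (π.hybrid (StrategyE.ofStageOracleE ω)))
    {X : Scheme.{u}} [IsLocallyNoetherian X] {x : X} (hX : IsMaximalOrigin p 3 ν X x)
    (hrep : StrataReplaySettleFromσE (π.hybrid (StrategyE.ofStageOracleE ω)) 3 ν (MarkedStageE.init X x (E₀ X x))
      fun s => s.geomDirDim < 3)
    (hmenu : StrataPolicySwallowFromσE π (π.hybrid (StrategyE.ofStageOracleE ω)) 3 ν (MarkedStageE.init X x (E₀ X x))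
      fun s => s.geomDirDim < 3)
    (hunits : NoMovingRecurrentNearChainFromσE (π.hybrid (StrategyE.ofStageOracleE ω)) 3 ν (MarkedStageE.init X x (E₀ X x))
      (fun s => s.geomDirDim < 3) fun s => Iso 3 s) :
    ∀ e, e < 3 → NoMovingNearChainFromσE (π.hybrid (StrategyE.ofStageOracleE ω)) 3 ν (MarkedStageE.init X x (E₀ X x))
      fun s => s.geomDirDim = e :=
  low_init_hybrid_of_rows_of_swallow_geomDir hK
    (Directrix214Sharp.theorem314_geomDir_of_thmIV_of_split h51 HerrmannIkedaOrbanz1988_cor_21_11_holds)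
    (Directrix214Sharp.theorem314_nearFibre_geomDir_of_facts h51 HerrmannIkedaOrbanz1988_cor_21_11_holds) hπ hω hadm hX hrep hmenu hunits

end Summit.ResolutionOfSingularities.ResolutionOfSingularities.Theorems.SigmaMaxModificationsCorridor3.Sigma

end
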